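import Summits.ResolutionOfSingularities.ResolutionOfSingularities.Theorems.WildPurityWildSymbolSymbolCalculus
import Summits.ResolutionOfSingularities.ResolutionOfSingularities.Theorems.WildPurityWildSymbolArcPlaces
import Summits.ResolutionOfSingularities.ResolutionOfSingularities.Theorems.WildPurityWildSymbolPerfectHullDense
import HarnessLib

/-!
# `WildSymbol` (stmt-ResolutionOfSingularities-17133), line `birth` — integrality calculus below a coarsening

Support file (lead c2, crux cycle 3) for crux #2 of route `ResolutionOfSingularities/WildPurity`
(`Summit.ResolutionOfSingularities.ResolutionOfSingularities.Theses.WildPurity.WildSymbol`; definitions in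
`Theorems/WildPurityWildSymbolBirthDefs.lean`: `G K ⧸ N p K` is Kato's symbolic `H³_p(K)`, `Unr p K T` the subgroup of
`T`-integral symbols). For valuation subrings `O ≤ W` of `K` (`W` a COARSENING of `O`, so `𝔪_W ⊆ 𝔪_O ⊆ O`) the
symbol identities that make the dévissage of integrality along `O ≤ W` work
(`Theorems/WildPurityWildSymbolResidualAbsorption.lean`):

* `sym_mul_self_mid` — `[y c, y, c} = 0` (`dy ∧ dlog c` is exact);
* `sym_mem_Unr_of_mem` — **`[x b c, b, c} ∈ Unr O` for `x, b, c ∈ O`**: the image of `Ω²_O` (`x·db ∧ dc`) is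
  integral, non-unit logarithmic entries being traded for units by the unit shift `db = d(1 + b)`;
* `sym_mem_Unr_of_nonunits_coarsening`, `sym_mem_Unr_of_mem_nonunits_coarsening` — a symbol whose coefficient
  lies in `𝔪_W` (against `W`-integral, resp. `W`-unit, logarithmic entries) is `O`-integral: `m·dlog b ∧ dlog c =
  (m/(bc))·db ∧ dc` with `m/(bc) ∈ 𝔪_W ⊆ O`, and `b ∉ O ⇒ b⁻¹ ∈ O`;
* `sym_one_add_mem_Unr_coarsening` — **`[a, 1 + m, c} ∈ Unr O`** for `a ∈ W`, `m ∈ 𝔪_W`, `c ∈ Wˣ`: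
  `x·dm ∧ dlog c = d(xm) ∧ dlog c − m·dx ∧ dlog c` (Leibniz = multiplicativity, `sym_d_add`);
* `sym_sub_sym_mem_Unr_of_congr` — LIFT INDEPENDENCE: symbols with `W`-integral coefficient and `W`-unit
  logarithmic entries that agree modulo `𝔪_W` differ by a class of `Unr O`.

No definition is declared; nothing concludes the crux.
-/

noncomputable section

-- single-problem summit: the doubled namespace component `ResolutionOfSingularities` is forced
set_option linter.dupNamespace false

namespace Summit.ResolutionOfSingularities.ResolutionOfSingularities.Theorems.WildSymbol.Birth

section Symbols

variable {p : ℕ} {K : Type} [Field K]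

set_option quotPrecheck false in
/-- `⟪a, b, c⟫` — the class of the symbol `[a, b, c}` in `G K ⧸ N p K` (local notation). -/
local notation "⟪" a ", " b ", " c "⟫" =>
  (((FreeAbelianGroup.of (((a : K), (b : Kˣ), (c : Kˣ)) : K × Kˣ × Kˣ) : G K)) : G K ⧸ N p K)

/-! ## Two more identities of the presentation -/

/-- `[y c, y, c} = 0` (`d y ∧ dlog c = d(y · dlog c)` is exact): shape (v) at `y c` minus alternation. [folklore] -/
theorem sym_mul_self_mid (y c : Kˣ) : ⟪(y : K) * c, y, c⟫ = 0 := by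
  have h := sym_self_mid (p := p) (y * c) c
  rw [Units.val_mul, sym_mul_mid, sym_diag, add_zero] at h
  exact h

/-- `[x b c, b, c}` with `x, b, c ∈ O` is `O`-integral — the image of `Ω²_O` (`x·db ∧ dc`) lies in `Unr O`:
a non-unit logarithmic entry `b ∈ 𝔪_O` is traded for the unit `1 + b` by the unit shift (`db = d(1 + b)`).
Middle slot. [folklore] -/
theorem exists_sym_eq_unit_mid (O : ValuationSubring K) {x : K} {b : Kˣ} (c : Kˣ) (hx : x ∈ O)
    (hb : (b : K) ∈ O) :
    ∃ (x' : K) (b' : Kˣ), x' ∈ O ∧ (b' : K) ∈ O ∧ (b' : K) ∉ O.nonunits ∧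
      ⟪x * b * c, b, c⟫ = ⟪x' * b' * c, b', c⟫ := by
  by_cases hbu : (b : K) ∈ O.nonunits
  · have h1b : (1 : K) + b ∉ O.nonunits := one_add_not_mem_nonunits O hbu
    obtain ⟨t, ht⟩ : ∃ t : Kˣ, (t : K) = 1 + b :=
      ⟨Units.mk0 (1 + b) (ne_zero_of_not_mem_nonunits O h1b), rfl⟩
    refine ⟨x, t, hx, ?_, by rwa [ht], ?_⟩
    · rw [ht]; exact O.add_mem _ _ O.one_mem hb
    · rw [sym_shift (x * b * c) b t c ht]
      congr 2
      rw [Units.val_inv_eq_inv_val]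
      field_simp
  · exact ⟨x, b, hx, hb, hbu, rfl⟩

/-- **`[x b c, b, c} ∈ Unr O` for `x, b, c ∈ O`** (the image of `Ω²_O` is integral): shift the middle slot to a
unit, swap the logarithmic slots (antisymmetry), shift again. [folklore] -/
theorem sym_mem_Unr_of_mem (O : ValuationSubring K) {x : K} {b c : Kˣ} (hx : x ∈ O) (hb : (b : K) ∈ O)
    (hc : (c : K) ∈ O) : ⟪x * b * c, b, c⟫ ∈ Unr p K O.toSubring := by
  obtain ⟨x', b', hx', hb', hb'u, h⟩ := exists_sym_eq_unit_mid (p := p) O c hx hb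
  rw [h, sym_antisymm, show x' * (b' : K) * c = x' * c * b' by ring]
  obtain ⟨x'', c', hx'', hc', hc'u, h'⟩ := exists_sym_eq_unit_mid (p := p) O b' hx' hc
  rw [h']
  exact (Unr p K O.toSubring).neg_mem
    (sym_mem_Unr_of_units O (O.mul_mem _ _ (O.mul_mem _ _ hx'' hc') hb') hc' hc'u hb' hb'u)

/-! ## Integrality below a coarsening: `O ≤ W`, so `𝔪_W ⊆ 𝔪_O ⊆ O` -/

/-- For `O ≤ W`, the non-units of `W` lie in `O`. [folklore] -/
theorem nonunits_subset_of_le {O W : ValuationSubring K} (hOW : O ≤ W) {y : K} (hy : y ∈ W.nonunits) :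
    y ∈ O :=
  O.nonunits_subset (ValuationSubring.nonunits_le_nonunits.mpr hOW hy)

/-- `[y b c, b, c} ∈ Unr O` for `y ∈ 𝔪_W`, `b ∈ W`, `c ∈ O` (`O ≤ W`): if `b ∉ O` then `b⁻¹ ∈ O` and
`[y b c, b, c} = −[(y b²) b⁻¹ c, b⁻¹, c}` with `y b² ∈ 𝔪_W ⊆ O`. [folklore] -/
theorem sym_mem_Unr_of_nonunits_of_mem_right {O W : ValuationSubring K} (hOW : O ≤ W) {y : K} {b c : Kˣ}
    (hy : y ∈ W.nonunits) (hb : (b : K) ∈ W) (hc : (c : K) ∈ O) :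
    ⟪y * b * c, b, c⟫ ∈ Unr p K O.toSubring := by
  rcases O.mem_or_inv_mem (b : K) with hbO | hbO
  · exact sym_mem_Unr_of_mem O (nonunits_subset_of_le hOW hy) hbO hc
  · have h : ⟪y * b * c, b, c⟫ = -⟪(y * b * b) * ↑b⁻¹ * c, b⁻¹, c⟫ := by
      rw [sym_inv_mid, neg_neg]
      congr 2
      rw [Units.val_inv_eq_inv_val]
      field_simp
    rw [h]
    refine (Unr p K O.toSubring).neg_mem (sym_mem_Unr_of_mem O ?_ ?_ hc)
    · exact nonunits_subset_of_le hOW (mul_mem_nonunits W (mul_mem_nonunits W hy hb) hb)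
    · rwa [Units.val_inv_eq_inv_val]

/-- **`[y b c, b, c} ∈ Unr O` for `y ∈ 𝔪_W` and `b, c ∈ W`** (`O ≤ W`). [folklore] -/
theorem sym_mem_Unr_of_nonunits_coarsening {O W : ValuationSubring K} (hOW : O ≤ W) {y : K} {b c : Kˣ}
    (hy : y ∈ W.nonunits) (hb : (b : K) ∈ W) (hc : (c : K) ∈ W) :
    ⟪y * b * c, b, c⟫ ∈ Unr p K O.toSubring := by
  rcases O.mem_or_inv_mem (c : K) with hcO | hcO
  · exact sym_mem_Unr_of_nonunits_of_mem_right hOW hy hb hcO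
  · have h : ⟪y * b * c, b, c⟫ = -⟪(y * c * c) * b * ↑c⁻¹, b, c⁻¹⟫ := by
      rw [sym_inv_right, neg_neg]
      congr 2
      rw [Units.val_inv_eq_inv_val]
      field_simp
    rw [h]
    refine (Unr p K O.toSubring).neg_mem (sym_mem_Unr_of_nonunits_of_mem_right hOW ?_ hb ?_)
    · exact mul_mem_nonunits W (mul_mem_nonunits W hy hc) hc
    · rwa [Units.val_inv_eq_inv_val]

/-- **A symbol with coefficient in `𝔪_W` and `W`-unit logarithmic entries is `O`-integral** (`O ≤ W`):
`[m, b, c} = [(m/(bc))·b·c, b, c}` with `m/(bc) ∈ 𝔪_W`. [folklore] -/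
theorem sym_mem_Unr_of_mem_nonunits_coarsening {O W : ValuationSubring K} (hOW : O ≤ W) {m : K} {b c : Kˣ} (hm : m ∈ W.nonunits) (hb' : ((b⁻¹ : Kˣ) : K) ∈ W) (hc' : ((c⁻¹ : Kˣ) : K) ∈ W) (hb : (b : K) ∈ W) (hc : (c : K) ∈ W) : ((FreeAbelianGroup.of (m, b, c) : G K) : G K ⧸ N p K) ∈ Unr p K O.toSubring := by
  have h : m = (m * ↑b⁻¹ * ↑c⁻¹) * b * c := by
    rw [Units.val_inv_eq_inv_val, Units.val_inv_eq_inv_val]; field_simp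
  rw [h]
  exact sym_mem_Unr_of_nonunits_coarsening hOW (mul_mem_nonunits W (mul_mem_nonunits W hm hb') hc') hb hc

/-- **`[a, 1 + m, c} ∈ Unr O`** for `a ∈ W`, `m ∈ 𝔪_W`, `c ∈ Wˣ` (`O ≤ W`): with `x = a/((1+m)c)`,
`x·dm ∧ dlog c = d(xm) ∧ dlog c − m·dx ∧ dlog c`; the first term vanishes (`sym_mul_self_mid`) and the second
has coefficient in `𝔪_W`. [folklore] -/
theorem sym_one_add_mem_Unr_coarsening {O W : ValuationSubring K} (hOW : O ≤ W) {a m : K} (u c : Kˣ)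
    (ha : a ∈ W) (hm : m ∈ W.nonunits) (hu : (u : K) = 1 + m) (hc : (c : K) ∈ W)
    (hc' : ((c⁻¹ : Kˣ) : K) ∈ W) : ⟪a, u, c⟫ ∈ Unr p K O.toSubring := by
  by_cases hm0 : m = 0
  · have hu1 : u = 1 := Units.ext (by rw [hu, hm0, add_zero, Units.val_one])
    rw [hu1, sym_one_mid]
    exact (Unr p K O.toSubring).zero_mem
  by_cases ha0 : a = 0
  · rw [ha0, sym_zero_left]
    exact (Unr p K O.toSubring).zero_mem
  have huW : (u : K) ∈ W := by rw [hu]; exact W.add_mem _ _ W.one_mem (W.nonunits_subset hm)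
  have huu : (u : K) ∉ W.nonunits := by rw [hu]; exact one_add_not_mem_nonunits W hm
  set x : K := a * ↑u⁻¹ * ↑c⁻¹ with hxdef
  have hx0 : x ≠ 0 := mul_ne_zero (mul_ne_zero ha0 (Units.ne_zero _)) (Units.ne_zero _)
  have hxW : x ∈ W := W.mul_mem _ _ (W.mul_mem _ _ ha (by
    rw [Units.val_inv_eq_inv_val]; exact inv_mem_of_not_mem_nonunits W huu)) hc'
  let mU : Kˣ := Units.mk0 m hm0
  let xU : Kˣ := Units.mk0 x hx0
  -- `a = (x c) u`
  have h1 : ⟪a, u, c⟫ = ⟪x * c * (u : K), u, c⟫ := by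
    congr 2
    rw [hxdef, Units.val_inv_eq_inv_val, Units.val_inv_eq_inv_val]
    field_simp
  -- `x c · du = x c · dm`
  have h2 := sym_d_add (p := p) (x * c) mU 1 u c (by rw [hu, Units.val_one, add_comm]; rfl)
  rw [Units.val_one, mul_one, sym_one_mid, add_zero] at h2
  -- Leibniz: `[x c m, m} = [x c m, x m} - [x c m, x}`
  have h3 : ⟪x * c * (mU : K), mU, c⟫ = ⟪x * c * (mU : K), xU * mU, c⟫ - ⟪x * c * (mU : K), xU, c⟫ := by
    rw [sym_mul_mid]; abel
  have h4 : ⟪x * c * (mU : K), xU * mU, c⟫ = 0 := by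
    have := sym_mul_self_mid (p := p) (xU * mU) c
    rwa [Units.val_mul, show ((xU : K) * (mU : K)) * c = x * c * (mU : K) by
      simp only [xU, mU, Units.val_mk0]; ring] at this
  have h5 : ⟪x * c * (mU : K), xU, c⟫ ∈ Unr p K O.toSubring := by
    have := sym_mem_Unr_of_nonunits_coarsening (p := p) hOW (b := xU) (c := c) hm
      (by simpa only [xU, Units.val_mk0] using hxW) hc
    rwa [show m * (xU : K) * c = x * c * (mU : K) by simp only [xU, mU, Units.val_mk0]; ring] at this
  rw [h1, ← h2, h3, h4, zero_sub]
  exact (Unr p K O.toSubring).neg_mem h5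

/-- **Lift independence.** For `O ≤ W`: if `a ≡ a'`, `b ≡ b'`, `c ≡ c'` modulo `𝔪_W` (`a' ∈ W`,
`b, b', c, c' ∈ Wˣ`; only the hypotheses actually used are kept), then `[a, b, c} − [a', b', c'} ∈ Unr O`.
[folklore] -/
theorem sym_sub_sym_mem_Unr_of_congr {O W : ValuationSubring K} (hOW : O ≤ W) {a a' : K} {b b' c c' : Kˣ}
    (ha' : a' ∈ W) (haa' : a - a' ∈ W.nonunits)
    (hb : (b : K) ∈ W) (hbi : ((b⁻¹ : Kˣ) : K) ∈ W) (hb' : (b' : K) ∈ W) (hb'i : ((b'⁻¹ : Kˣ) : K) ∈ W)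
    (hbb' : (b : K) - b' ∈ W.nonunits)
    (hc : (c : K) ∈ W) (hci : ((c⁻¹ : Kˣ) : K) ∈ W) (hc'i : ((c'⁻¹ : Kˣ) : K) ∈ W)
    (hcc' : (c : K) - c' ∈ W.nonunits) :
    ⟪a, b, c⟫ - ⟪a', b', c'⟫ ∈ Unr p K O.toSubring := by
  have e : ⟪a, b, c⟫ - ⟪a', b', c'⟫ = (⟪a, b, c⟫ - ⟪a', b, c⟫) + (⟪a', b, c⟫ - ⟪a', b', c⟫)
      + (⟪a', b', c⟫ - ⟪a', b', c'⟫) := by abel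
  rw [e]
  refine (Unr p K O.toSubring).add_mem ((Unr p K O.toSubring).add_mem ?_ ?_) ?_
  · -- first slot: `[a - a', b, c}` has coefficient in `𝔪_W`
    rw [← sym_sub_left]
    exact sym_mem_Unr_of_mem_nonunits_coarsening hOW haa' hbi hci hb hc
  · -- middle slot: `[a', b/b', c}` with `b/b' = 1 + (b - b')/b'`
    have h : ⟪a', b, c⟫ - ⟪a', b', c⟫ = ⟪a', b * b'⁻¹, c⟫ := by
      conv_lhs => rw [← inv_mul_cancel_right b b', sym_mul_mid]
      abel
    rw [h]
    refine sym_one_add_mem_Unr_coarsening hOW (b * b'⁻¹) c ha' (m := ((b : K) - b') * ↑b'⁻¹)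
      (mul_mem_nonunits W hbb' hb'i) ?_ hc hci
    rw [Units.val_mul, Units.val_inv_eq_inv_val]
    field_simp
    ring
  · -- last slot, by antisymmetry
    have h : ⟪a', b', c⟫ - ⟪a', b', c'⟫ = -⟪a', c * c'⁻¹, b'⟫ := by
      conv_lhs => rw [← inv_mul_cancel_right c c', sym_mul_right]
      rw [sym_antisymm a' (c * c'⁻¹) b']
      abel
    rw [h]
    refine (Unr p K O.toSubring).neg_mem
      (sym_one_add_mem_Unr_coarsening hOW (c * c'⁻¹) b' ha' (m := ((c : K) - c') * ↑c'⁻¹)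
        (mul_mem_nonunits W hcc' hc'i) ?_ hb' hb'i)
    rw [Units.val_mul, Units.val_inv_eq_inv_val]
    field_simp
    ring

end Symbols

end Summit.ResolutionOfSingularities.ResolutionOfSingularities.Theorems.WildSymbol.Birth

end
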